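/-
Copyright (c) 2026. All rights reserved.
Released under Apache 2.0 license as described in the file LICENSE.
-/
import Summits.HubbardSuperconductivity.HubbardLadder.NeelTwoSumRuleRowsTen
import Summits.HubbardSuperconductivity.HubbardLadder.NeelOrderParamCeiling
import HarnessLib

/-!
# R2 rows A5(8), A5(10): two-sided KERNEL brackets on the Néel order parameter of the
# `8 × 8` and `10 × 10` Heisenberg antiferromagnet (S = ½, J > 0)

HONEST FRAMING: ladder R1–R4 with certified numbers; no claim on H/H₀.
Cell `pub-hubbard`, seat r2, R2-TABLE rows A5 / A8.8 / A8.10 (ROWS-PENDING §D).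

This file only ASSEMBLES landed endpoints into single bracket statements, exactly like
`NeelOrderParamCeiling.neelOrderParamSq_four_mem_Icc` / `_six_mem_Icc`:
* lower endpoints — the energy-free infrared (KLS two-sum-rule) rows
  `NeelTwoSumRuleRowsEight.neelOrderParamSq_eight_ge` (`0.0329`) and
  `NeelTwoSumRuleRowsTen.neelOrderParamSq_ten_ge` (`0.0041`), and their sharper versions under ONE
  inherited energy hypothesis (pub-mbboot E2 cluster-mean-field upper bounds `[H_8]`, `[H_10]`,
  cited by name, not re-proved): `0.0355` resp. `0.0043`;
* upper endpoints — the operator (Casimir) ceiling `NeelOrderParamCeiling.neelOrderParamSq_le`: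
  `¼ + 1/L²` = `0.265625` resp. `0.26`.

| row | `L` | certified bracket on `m_s²(L) = L⁻⁴ Σ_{x,y} ε_xε_y ⟨𝐒_x·𝐒_y⟩₀` | hypothesis | QMC (Sandvik 2026, Tab. I; comparator) |
|-----|-----|------------------------------------------------------------------|------------|------------------------------------------|
| A5(8)   | 8  | `[0.0329, 0.265625]` | none (every `J > 0`) | `0.1778419(2)` — inside |
| A5′(8)  | 8  | `[0.0355, 0.265625]` | `E₀(8×8, J=1) ≤ -39.9615808` | inside |
| A5(10)  | 10 | `[0.0041, 0.26]`     | none                 | `0.1593710(2)` — inside |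
| A5′(10) | 10 | `[0.0043, 0.26]`     | `E₀(10×10, J=1) ≤ -58.40533` | inside |
`L = 10` is the last size at which the infrared device gives a positive floor (method ceiling `L = 12`,
IR-ROWS §5); Néel order of the `S = ½` square-lattice antiferromagnet in the thermodynamic limit is OPEN
and nothing here bears on it.

## References
* T. Kennedy, E. H. Lieb, B. S. Shastry, J. Stat. Phys. 53 (1988) 1019, eq. (14) and App. A.
  [cite: KLS1988JSP, eq. (14)]
* A. W. Sandvik, J. Stat. Mech. (2026) 043101, Table I (SSE values of `m_s²(L)`; comparator only). [cite: Sandvik2026, Table I]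
-/

noncomputable section

open Literature.MathematicalPhysics.QuantumLattice

namespace Summit.HubbardSuperconductivity.HubbardLadder

/-- **R2 row A5(8)**: `m_s²(8) ∈ [0.0329, 0.265625]` for every `J > 0` (no energy input).
[cite: KLS1988JSP, eq. (14)] -/
theorem neelOrderParamSq_eight_mem_Icc (J : ℝ) (hJ : 0 < J) :
    neelOrderParamSq 8 J ∈ Set.Icc (0.0329 : ℝ) 0.265625 :=
  ⟨neelOrderParamSq_eight_ge J hJ, neelOrderParamSq_eight_le J⟩

/-- **R2 row A5′(8)**: `m_s²(8) ∈ [0.0355, 0.265625]` for every `J > 0`, given the inherited energy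
certificate `E₀(8×8, J = 1) ≤ -39.9615808` (pub-mbboot `[H_8]`). [cite: KLS1988JSP, eq. (14)] -/
theorem neelOrderParamSq_eight_mem_Icc_of_groundEnergy_le (J : ℝ) (hJ : 0 < J)
    (hE : (heisenbergTorus 2 8 1 1).groundEnergy ≤ -39.9615808) :
    neelOrderParamSq 8 J ∈ Set.Icc (0.0355 : ℝ) 0.265625 :=
  ⟨neelOrderParamSq_eight_ge_of_groundEnergy_le J hJ hE, neelOrderParamSq_eight_le J⟩

/-- **R2 row A5(10)**: `m_s²(10) ∈ [0.0041, 0.26]` for every `J > 0` (no energy input).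
[cite: KLS1988JSP, eq. (14)] -/
theorem neelOrderParamSq_ten_mem_Icc (J : ℝ) (hJ : 0 < J) :
    neelOrderParamSq 10 J ∈ Set.Icc (0.0041 : ℝ) 0.26 :=
  ⟨neelOrderParamSq_ten_ge J hJ, neelOrderParamSq_ten_le J⟩

/-- **R2 row A5′(10)**: `m_s²(10) ∈ [0.0043, 0.26]` for every `J > 0`, given the inherited energy
certificate `E₀(10×10, J = 1) ≤ -58.40533` (pub-mbboot `[H_10]`). [cite: KLS1988JSP, eq. (14)] -/
theorem neelOrderParamSq_ten_mem_Icc_of_groundEnergy_le (J : ℝ) (hJ : 0 < J)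
    (hE : (heisenbergTorus 2 10 1 1).groundEnergy ≤ -58.40533) :
    neelOrderParamSq 10 J ∈ Set.Icc (0.0043 : ℝ) 0.26 :=
  ⟨neelOrderParamSq_ten_ge_of_groundEnergy_le J hJ hE, neelOrderParamSq_ten_le J⟩

end Summit.HubbardSuperconductivity.HubbardLadder
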